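import Literature.Geometry.Riemannian.ThreeShrinkerDegenerateLeafJacobi
import Literature.Geometry.Riemannian.ThreeShrinkerFlatCase
import HarnessLib

/-!
# Degenerate three-dimensional shrinkers: the exponential map in closed form (Cartan data)

Continuation of `ThreeShrinkerDegenerateLeaves` / `…LeafFrame` / `…LeafJacobi` / `…Round`
(degenerate case of Munteanu–Wang 2016, Thm. 1.2). On a complete connected normalised shrinker
(`Ric + Hess f = ½ g`, `S + |∇f|² = f`) of dimension three with `Ric ≥ 0`, `S > 0`, a null vector
of `Ric`, and — the output of `ThreeShrinkerDegenerateRound` — `S ≡ 1`, the local geometry is that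
of `S²(√2) × ℝ`: the unit null field `ν` of `Ric` is parallel, `Ric = ½(g − ν♭ ⊗ ν♭)`, and the
leaf planes `ν^⊥` have curvature `S/2 = ½`. This file turns that into the two closed-form identities
along geodesics that drive the developing map onto the model cylinder
(`ThreeShrinkerDegenerateDeveloping`):

* `curvature_frame_general` — in an orthonormal frame `(e₀, e₁, e₂)` with `e₂` null, for the
  velocity `V = ρ e₀ + s e₂`: `⟨R(e_j, V)V, e_i⟩ = ρ² (S/2) δ_{i1} δ_{j1}` (the only curvature an
  orthogonal Jacobi field feels is `½ ρ²` in the leaf-normal direction `e₁`);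
* `hessian_apply_self` — `Hess f(X, X) = ½ κ(X)` (`κ(X) = ⟨ν, X⟩²`), hence
  **`potential_maximalGeodesic`** — from a critical point `p` of `f` with `f(p) = 1`,
  `f(γ_v(t)) = 1 + κ(v) t²/4`, i.e. **`f(exp_p(w + sν)) = 1 + s²/4`** (`potential_expMap`);
* **`val_jacobi_sq`** (Cartan's formula) — for `v = ρ u + s ν` (`(u, n, ν)` orthonormal at `p`, `ν`
  null) and the Jacobi field `J` along `γ_v` with `J(0) = 0`, `D_tJ(0) = ξ`:
  `|J(t)|² = (⟨ξ,u⟩ t)² + (⟨ξ,n⟩ j(t))² + (⟨ξ,ν⟩ t)²` for the solution `j` of `j'' = −(ρ²/2) j`,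
  `j(0) = 0`, `j'(0) = 1` (`j = (√2/ρ) sin(ρt/√2)`); with `J(1) = d(exp_p)_v(ξ)`
  (`JacobiVariation`) this is **`val_mfderiv_expMap_sq`**:
  `|d(exp_p)_v ξ|² = ⟨ξ,u⟩² + j(1)² ⟨ξ,n⟩² + ⟨ξ,ν⟩²` — the metric of `S²(√2) × ℝ` in normal
  coordinates — and its polarisation `val_mfderiv_expMap`.

Everything is proved; no new definitions (D-0026).

## References

* O. Munteanu, J. Wang, *Structure at infinity for shrinking Ricci solitons*, arXiv:1606.01861,
  Thm. 1.2 (p. 3). [MunteanuWang2016]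
* P. Petersen, W. Wylie, *On the classification of gradient Ricci solitons*, Geom. Topol. 14
  (2010), §3 (rigidity: parallel null direction, local splitting). [PetersenWylie2010]
* I. Chavel, *Riemannian Geometry: A Modern Introduction*, 2nd ed., CUP 2006, §II.5–II.6 and
  Thm. II.6.3 (Jacobi fields and `d exp`), §III.1. [Chavel2006]
* B. O'Neill, *Semi-Riemannian Geometry*, Academic Press 1983, Ch. 8, Prop. 8.6 and Ch. 3,
  Prop. 3.36. [ONeill1983]
-/

noncomputable section

open Bundle Set Function Filter Module Metric
open scoped Manifold ContDiff Topology NNReal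

namespace Literature.Geometry.Riemannian

open Lorentzian Lorentzian.PseudoRiemannianMetric
open Literature.Analysis.ODE.ShrinkerLeafProfile

variable {M : Type*} [TopologicalSpace M] [ChartedSpace (EuclideanSpace ℝ (Fin 3)) M]
  [IsManifold (𝓡 3) ∞ M]
  (g : PseudoRiemannianMetric (𝓡 3) ∞ (EuclideanSpace ℝ (Fin 3)) (TangentSpace (𝓡 3) : M → Type _))
  [g.HasLeviCivita]

namespace DegenerateShrinker

section Along

variable [T2Space M] [ConnectedSpace M]
  -- `hg : g.IsRiemannian`, unfolded (positive definiteness on every tangent space)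
  (hg : ∀ (x : M) (v : TangentSpace (𝓡 3) x), v ≠ 0 → 0 < g.val x v v)
  {f : M → ℝ} (hf : ContMDiff (𝓡 3) 𝓘(ℝ, ℝ) ∞ f) {lam : ℝ}
  (hsol : ∀ (x : M) (X Y : TangentSpace (𝓡 3) x),
    g.ricci x X Y + g.hessian f x X Y = lam * g.val x X Y)
  (hRic0 : ∀ (x : M) (w : TangentSpace (𝓡 3) x), 0 ≤ g.ricci x w w)
  (hS : ∀ x, 0 < g.scalarCurvature x) {p₀ : M} {w₀ : TangentSpace (𝓡 3) p₀} (hw₀ : w₀ ≠ 0)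
  (hnull : g.ricci p₀ w₀ w₀ = 0)
  {κ : (x : M) → TangentSpace (𝓡 3) x → ℝ}
  (hκ : ∀ (x : M) (w : TangentSpace (𝓡 3) x),
    κ x w = g.val x w w - 2 / g.scalarCurvature x * g.ricci x w w)
include hg hf hsol hRic0 hS hw₀ hnull

/-! ### Curvature along a general velocity `V = ρ e₀ + s e₂` -/

omit [T2Space M] in
/-- **Curvature in an adapted frame, general velocity.** For an orthonormal frame `(e₀, e₁, e₂)`
at `x` with `Ric(e₂, e₂) = 0` and `V = ρ e₀ + s e₂`:
`⟨R(e_j, V)V, e_i⟩ = ρ² (S/2)` if `i = j = 1` and `0` otherwise (`R(·, e₂) = 0`, `R(·,·)e₂ = 0`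
by pair symmetry, and `K(e₀, e₁) = S/2`). [cite: PetersenWylie2010, §3]
[cite: ONeill1983, Ch. 3, Prop. 3.36] -/
theorem curvature_frame_general {x : M} {e : Fin 3 → TangentSpace (𝓡 3) x}
    (hon : ∀ i j, g.val x (e i) (e j) = if i = j then 1 else 0) (hν : g.ricci x (e 2) (e 2) = 0)
    (ρ s : ℝ) (i j : Fin 3) :
    g.val x (g.riemann x (e j) (ρ • e 0 + s • e 2) (ρ • e 0 + s • e 2)) (e i) =
      if i = 1 ∧ j = 1 then ρ ^ 2 * (g.scalarCurvature x / 2) else 0 := by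
  obtain ⟨hGm, hGpos, -, -, hSpos, O, -, hu₀O, hOT, v, -, -, hunit, -, hRicO, hRiemO⟩ :=
    exists_chart_data g hg hf hsol hRic0 hS hw₀ hnull x
  have hxs : x ∈ (extChartAt (𝓡 3) x).source := mem_extChartAt_source x
  set G := chartRep (𝓡 3) (fun _ ↦ g) x 0 with hGdef
  set z := extChartAt (𝓡 3) x x with hz
  have hzT : z ∈ (extChartAt (𝓡 3) x).target := mem_extChartAt_target x
  have hsy := hGm.symm z hzT
  set uh : EuclideanSpace ℝ (Fin 3) := mfderiv (𝓡 3) (𝓡 3) (extChartAt (𝓡 3) x) x (e 0) with huh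
  set nh : EuclideanSpace ℝ (Fin 3) := mfderiv (𝓡 3) (𝓡 3) (extChartAt (𝓡 3) x) x (e 1) with hnh
  set νh : EuclideanSpace ℝ (Fin 3) := mfderiv (𝓡 3) (𝓡 3) (extChartAt (𝓡 3) x) x (e 2) with hνh
  -- the dictionary
  have dv : ∀ a b : TangentSpace (𝓡 3) x, g.val x a b =
      G z (mfderiv (𝓡 3) (𝓡 3) (extChartAt (𝓡 3) x) x a)
        (mfderiv (𝓡 3) (𝓡 3) (extChartAt (𝓡 3) x) x b) := fun a b ↦
    (dictionary_source g x hxs hf a b).1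
  have dr : ∀ a b : TangentSpace (𝓡 3) x, g.ricci x a b =
      MetricCoord.ricAt G z (mfderiv (𝓡 3) (𝓡 3) (extChartAt (𝓡 3) x) x a)
        (mfderiv (𝓡 3) (𝓡 3) (extChartAt (𝓡 3) x) x b) := fun a b ↦
    (dictionary_source g x hxs hf a b).2.1
  have dS : g.scalarCurvature x = MetricCoord.scalAt G z :=
    (dictionary_source g x hxs hf (e 0) (e 0)).2.2.1
  have guu : G z uh uh = 1 := by rw [← dv]; simpa using hon 0 0
  have gnn : G z nh nh = 1 := by rw [← dv]; simpa using hon 1 1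
  have gνν : G z νh νh = 1 := by rw [← dv]; simpa using hon 2 2
  have gun : G z uh nh = 0 := by rw [← dv]; simpa using hon 0 1
  have guν : G z uh νh = 0 := by rw [← dv]; simpa using hon 0 2
  have gnν : G z nh νh = 0 := by rw [← dv]; simpa using hon 1 2
  -- `νh = θ v` with `θ² = 1`, hence `R(·, νh) = 0`
  set θ := G z (v z) νh with hθ
  have hνnull : MetricCoord.ricAt G z νh νh = 0 := by rw [← dr]; exact hν
  have hνsq : G z νh νh = θ ^ 2 := by
    rw [hRicO z hu₀O] at hνnull
    have h2 : MetricCoord.scalAt G z / 2 ≠ 0 := div_ne_zero (hSpos z hzT).ne' two_ne_zero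
    have h3 := (mul_eq_zero.mp hνnull).resolve_left h2
    rw [hθ, sq]; linarith
  have hνv : νh = θ • v z := eq_smul_of_apply_self_eq_sq (hGpos z hzT) hsy (hunit z hu₀O) hνsq
  have hθ2 : θ ^ 2 = 1 := by rw [← hνsq, gνν]
  have hvν : v z = θ • νh := by
    rw [hνv, smul_smul, ← sq, hθ2, one_smul]
  have hRν : ∀ X, MetricCoord.riemAt G z X νh = 0 := fun X ↦ by
    rw [hνv, MetricCoord.riemAt_smul_right, hRiemO z hu₀O, smul_zero]
  have hθu : G z (v z) uh = 0 := by
    rw [hvν, map_smul, FunLike.coe_smul, Pi.smul_apply, hsy νh uh, guν, smul_zero]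
  -- `G(R(a, uh) νh, b) = 0` (pair symmetry)
  have hsec : ∀ a b, G z (MetricCoord.riemAt G z a uh νh) b = 0 := fun a b ↦ by
    rw [hGm.apply_riemAt_pair_comm hzT a uh νh b, MetricCoord.riemAt_swap G z b νh, hRν b,
      neg_zero, _root_.zero_apply, map_zero, _root_.zero_apply]
  -- the reduction `G(R(a, V)V, b) = ρ² G(R(a, uh)uh, b)`
  have hkey : ∀ a b, G z (MetricCoord.riemAt G z a (ρ • uh + s • νh) (ρ • uh + s • νh)) b =
      ρ ^ 2 * G z (MetricCoord.riemAt G z a uh uh) b := by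
    intro a b
    rw [MetricCoord.riemAt_add_right, MetricCoord.riemAt_smul_right, MetricCoord.riemAt_smul_right,
      hRν a, smul_zero, add_zero]
    simp only [_root_.smul_apply, map_add, map_smul, _root_.add_apply, smul_eq_mul]
    rw [hsec a b]
    ring
  -- the entries `m_{ij} = G(R(e_j, uh)uh, e_i)`
  have m_u : ∀ b, G z (MetricCoord.riemAt G z uh uh uh) b = 0 := fun b ↦ by
    rw [MetricCoord.riemAt_self, _root_.zero_apply, map_zero, _root_.zero_apply]
  have m_ν : ∀ b, G z (MetricCoord.riemAt G z νh uh uh) b = 0 := fun b ↦ by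
    rw [MetricCoord.riemAt_swap G z uh νh, hRν uh, neg_zero, _root_.zero_apply, map_zero,
      _root_.zero_apply]
  have m_nu : G z (MetricCoord.riemAt G z nh uh uh) uh = 0 := by
    have h := hGm.apply_riemAt_swap hzT nh uh uh uh
    linarith
  have m_nν : G z (MetricCoord.riemAt G z nh uh uh) νh = 0 := by
    rw [hGm.apply_riemAt_pair_comm hzT nh uh uh νh, hRν uh, _root_.zero_apply, map_zero,
      _root_.zero_apply]
  have m_nn : G z (MetricCoord.riemAt G z nh uh uh) nh = MetricCoord.scalAt G z / 2 := by
    have hon' : ∀ i j : Fin 3, G z (![uh, nh, νh] i) (![uh, nh, νh] j) = if i = j then 1 else 0 := by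
      intro i j
      fin_cases i <;> fin_cases j <;>
        simp [guu, gnn, gνν, gun, guν, gnν, hsy nh uh, hsy νh uh, hsy νh nh]
    have hli := linearIndependent_of_bilin_orthonormal (G z) hon'
    have hcard : Fintype.card (Fin 3) = finrank ℝ (EuclideanSpace ℝ (Fin 3)) := by simp
    set b : Basis (Fin 3) ℝ (EuclideanSpace ℝ (Fin 3)) :=
      basisOfLinearIndependentOfCardEqFinrank hli hcard with hb_def
    have hb : ⇑b = ![uh, nh, νh] := coe_basisOfLinearIndependentOfCardEqFinrank hli hcard
    have hb' : ∀ i j, G z (b i) (b j) = if i = j then 1 else 0 := by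
      intro i j; rw [hb]; exact hon' i j
    have hsum := MetricCoord.ricAt_eq_sum_of_orthonormal b hb' uh uh
    rw [Fin.sum_univ_three, hb] at hsum
    have h0 : (![uh, nh, νh] : Fin 3 → EuclideanSpace ℝ (Fin 3)) 0 = uh := rfl
    have h1 : (![uh, nh, νh] : Fin 3 → EuclideanSpace ℝ (Fin 3)) 1 = nh := rfl
    have h2 : (![uh, nh, νh] : Fin 3 → EuclideanSpace ℝ (Fin 3)) 2 = νh := rfl
    rw [h0, h1, h2] at hsum
    rw [m_u uh, m_ν νh, zero_add, add_zero, hRicO z hu₀O, guu, hθu] at hsum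
    rw [← hsum]; ring
  -- back on the manifold
  have hV : mfderiv (𝓡 3) (𝓡 3) (extChartAt (𝓡 3) x) x (ρ • e 0 + s • e 2) = ρ • uh + s • νh := by
    rw [map_add, map_smul, map_smul, huh, hνh]
    rfl
  have hgen : ∀ k, mfderiv (𝓡 3) (𝓡 3) (extChartAt (𝓡 3) x) x (e k) = ![uh, nh, νh] k := by
    intro k; fin_cases k <;> rfl
  rw [val_riemann_source g x hxs, hV, hgen i, hgen j, hkey, dS]
  fin_cases i <;> fin_cases j <;> simp [m_u, m_ν, m_nu, m_nν, m_nn]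

/-! ### The potential along geodesics from a critical point of `Σ₀` -/

omit [T2Space M] [ConnectedSpace M] hg hf hRic0 hw₀ hnull in
include hκ in
/-- **`Hess f(X, X) = λ|X|² − (S/2)(|X|² − κ(X))`**, i.e. `= ½ κ(X)` when `λ = ½`, `S = 1`. [folklore] -/
theorem hessian_apply_self (x : M) (X : TangentSpace (𝓡 3) x) :
    g.hessian f x X X = lam * g.val x X X - g.scalarCurvature x / 2 * (g.val x X X - κ x X) := by
  have h := hsol x X X
  rw [ricci_eq_of_kappa g hS hκ x X] at h
  linarith

include hκ in
/-- **The potential along a geodesic from a critical point of `f` with `f(p) = 1`** on a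
normalised degenerate shrinker with `S ≡ 1`: `f(γ_v(t)) = 1 + κ(v) t²/4`
(`(f∘γ)'' = Hess f(γ̇,γ̇) = ½ κ(γ̇) = ½ κ(v)`, `κ` being constant along geodesics).
[cite: MunteanuWang2016, Thm. 1.2] -/
theorem potential_maximalGeodesic (hlam : lam = 1 / 2) (hS1 : ∀ x, g.scalarCurvature x = 1)
    (hc : IsGeodesicallyComplete g.leviCivita) {p : M} (hfp : f p = 1)
    (hdf : mvfderiv (𝓡 3) f p = 0) (v : TangentSpace (𝓡 3) p) (t : ℝ) :
    f (maximalGeodesic g.leviCivita p v t) = 1 + κ p v * t ^ 2 / 4 := by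
  subst hlam
  haveI := contMDiffCovariantDerivative_leviCivita_one g
  obtain ⟨-, hgeo, hγ0, hγv⟩ := maximalGeodesic_of_isGeodesicallyComplete hc p v
  have hb : maximalGeodesic g.leviCivita p v 0 = p := hγ0
  have hF := fun s ↦ hasDerivAt_f g hg hf hsol hRic0 hS hw₀ hnull hgeo s
  have hG : ∀ s, HasDerivAt (fun s ↦ mvfderiv (𝓡 3) f (maximalGeodesic g.leviCivita p v s)
      (velocity (𝓡 3) (maximalGeodesic g.leviCivita p v) s)) (κ p v / 2) s := by
    intro s
    have h := hasDerivAt_mvfderiv_velocity g hg hf hsol hRic0 hS hw₀ hnull hκ hgeo s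
    rw [kappa_velocity_eq g hg hf hsol hRic0 hS hw₀ hnull hκ hgeo s, hγv, hb, hS1] at h
    refine h.congr_deriv ?_
    ring
  have h := ThreeShrinker.eq_quadratic_of_hasDerivAt hF hG t
  rw [h, hb, hfp, hγv, hdf, _root_.zero_apply]
  ring

include hκ in
/-- **`f(exp_p v) = 1 + κ(v)/4`** (`= 1 + s²/4` for `v = w + sν`, `w` a leaf vector) from a critical
point `p` of `f` with `f(p) = 1`. [cite: MunteanuWang2016, Thm. 1.2] -/
theorem potential_expMap (hlam : lam = 1 / 2) (hS1 : ∀ x, g.scalarCurvature x = 1)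
    (hc : IsGeodesicallyComplete g.leviCivita) {p : M} (hfp : f p = 1)
    (hdf : mvfderiv (𝓡 3) f p = 0) (v : TangentSpace (𝓡 3) p) :
    f (expMap g.leviCivita p v) = 1 + κ p v / 4 := by
  haveI := contMDiffCovariantDerivative_leviCivita_one g
  rw [expMap_eq_maximalGeodesic hc,
    potential_maximalGeodesic g hg hf hsol hRic0 hS hw₀ hnull hκ hlam hS1 hc hfp hdf v 1]
  ring

omit [T2Space M] in
include hκ in
/-- `κ(ρ u + s ν) = s²` for `g(u, ν) = 0` and `ν` a unit null vector. [folklore] -/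
theorem kappa_smul_add_smul {x : M} {u ν : TangentSpace (𝓡 3) x} (hνν : g.val x ν ν = 1)
    (huν : g.val x u ν = 0) (hν : g.ricci x ν ν = 0) (ρ s : ℝ) :
    κ x (ρ • u + s • ν) = s ^ 2 := by
  rw [kappa_eq_sq_of_unit_null g hg hf hsol hRic0 hS hw₀ hnull hκ hνν hν]
  simp only [map_add, map_smul, smul_eq_mul]
  rw [g.symm x ν u, huν, hνν]
  ring

/-! ### Cartan's formula: `|J(t)|²` for the Jacobi fields along `γ_{ρu + sν}` -/

set_option maxHeartbeats 1600000 in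
include hκ in
/-- **Cartan's formula for a degenerate three-dimensional shrinker.** Let `(u, n, ν)` be
orthonormal at `p` with `Ric(ν, ν) = 0`, `v = ρ u + s ν`, `S ≡ 1`, and let `J` be the Jacobi
field along `γ_v` with `J(0) = 0`, `D_tJ(0) = ξ` (the variation field of `s' ↦ γ_{v + s'ξ}`). In the
parallel frame along `γ_v` the components of `J` solve `a₀'' = 0`, `a₁'' = −(ρ²/2) a₁`, `a₂'' = 0`
(`curvature_frame_general`), so for the solution `j` of `j'' = −(ρ²/2) j`, `j(0) = 0`, `j'(0) = 1`:
`|J(t)|² = (⟨ξ,u⟩t)² + (⟨ξ,n⟩ j(t))² + (⟨ξ,ν⟩ t)²` for `t ∈ (−2, 2)`.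
[cite: Chavel2006, §II.5–II.6] [cite: MunteanuWang2016, Thm. 1.2] -/
theorem val_jacobi_sq (hS1 : ∀ x, g.scalarCurvature x = 1)
    (hc : IsGeodesicallyComplete g.leviCivita) {p : M} {u n ν : TangentSpace (𝓡 3) p}
    (huu : g.val p u u = 1) (hnn : g.val p n n = 1) (hνν : g.val p ν ν = 1)
    (hun : g.val p u n = 0) (huν : g.val p u ν = 0) (hnν : g.val p n ν = 0)
    (hν : g.ricci p ν ν = 0) (ρ s : ℝ) {j j₁ : ℝ → ℝ} (hj : ∀ t, HasDerivAt j (j₁ t) t)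
    (hj₁ : ∀ t, HasDerivAt j₁ (-(ρ ^ 2 / 2) * j t) t) (hj0 : j 0 = 0) (hj₁0 : j₁ 0 = 1)
    (ξ : TangentSpace (𝓡 3) p) {t : ℝ} (ht : t ∈ Ioo (-2 : ℝ) 2) :
    g.val (maximalGeodesic g.leviCivita p (ρ • u + s • ν) t)
      (velocity (𝓡 3) (fun s' : ℝ ↦ maximalGeodesic g.leviCivita p (ρ • u + s • ν + s' • ξ) t) 0)
      (velocity (𝓡 3) (fun s' : ℝ ↦ maximalGeodesic g.leviCivita p (ρ • u + s • ν + s' • ξ) t) 0) =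
      (g.val p ξ u * t) ^ 2 + (g.val p ξ n * j t) ^ 2 + (g.val p ξ ν * t) ^ 2 := by
  haveI := contMDiffCovariantDerivative_leviCivita_one g
  haveI := contMDiffCovariantDerivative_leviCivita_infty g le_rfl
  have hLC := PseudoRiemannianMetric.isLeviCivita_leviCivita_holds (g := g)
  have hn2 : (2 : ℕ∞ω) ≤ ∞ := WithTop.coe_le_coe.2 le_top
  have hreg : g.leviCivita.IsLocallyContMDiff 1 := hLC.isLocallyContMDiff_one hn2
  have hg' : g.IsRiemannian := hg
  set v : TangentSpace (𝓡 3) p := ρ • u + s • ν with hvdef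
  obtain ⟨-, hgeo, hγ0, hγv⟩ := maximalGeodesic_of_isGeodesicallyComplete hc p v
  set γ : ℝ → M := maximalGeodesic g.leviCivita p v with hγdef
  have hb : γ 0 = p := hγ0
  have hsymm := g.symm p
  -- the Jacobi field
  obtain ⟨hJac, hJ0, hDJ0, hJd, hDJd⟩ := jacobiField_geodesicVariation g hreg hc p v ξ
  have hv0 : v + (0 : ℝ) • ξ = v := by rw [zero_smul, add_zero]
  rw [hv0] at hJac hJ0 hDJ0 hJd hDJd
  set J : Π t : ℝ, TangentSpace (𝓡 3) (γ t) := fun t ↦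
    velocity (𝓡 3) (fun s' : ℝ ↦ maximalGeodesic g.leviCivita p (v + s' • ξ) t) 0 with hJdef
  -- the parallel orthonormal frame `(E₀, E₁, E₂)` from `(u, n, ν)` on `(−2, 2)`
  have h0I : (0 : ℝ) ∈ Ioo (-2 : ℝ) 2 := ⟨by norm_num, by norm_num⟩
  set wfr : Fin 3 → TangentSpace (𝓡 3) (γ 0) := fun i ↦
    (![u, n, ν] : Fin 3 → EuclideanSpace ℝ (Fin 3)) i with hwfr
  have hw : ∀ i j, g.val (γ 0) (wfr i) (wfr j) = if i = j then 1 else 0 := by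
    intro i j
    rw [hb]
    fin_cases i <;> fin_cases j
    · simpa [hwfr] using huu
    · simpa [hwfr] using hun
    · simpa [hwfr] using huν
    · simpa [hwfr, hsymm u n] using hun
    · simpa [hwfr] using hnn
    · simpa [hwfr] using hnν
    · simpa [hwfr, hsymm u ν] using huν
    · simpa [hwfr, hsymm n ν] using hnν
    · simpa [hwfr] using hνν
  obtain ⟨Efr, hE0, hEpar, hEon⟩ :=
    exists_parallel_orthonormal_frame_maximalGeodesic g hg' hc p v h0I wfr hw
  have hE00 : Efr 0 0 = u := by rw [hE0]; rfl
  have hE10 : Efr 1 0 = n := by rw [hE0]; rfl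
  have hE20 : Efr 2 0 = ν := by rw [hE0]; rfl
  -- `E₂` stays null
  have hκν : κ p ν = 1 := by rw [hκ, hνν, hν, mul_zero, sub_zero]
  have hνnull : ∀ t ∈ Ioo (-2 : ℝ) 2, g.ricci (γ t) (Efr 2 t) (Efr 2 t) = 0 := by
    intro t ht
    have hk : κ (γ t) (Efr 2 t) = 1 := by
      rw [kappa_parallel_eq g hg hf hsol hRic0 hS hw₀ hnull hκ hgeo (hEpar 2) ht h0I]
      rw [hE20, hb]
      exact hκν
    have h22 : g.val (γ t) (Efr 2 t) (Efr 2 t) = 1 := by simpa using hEon t ht 2 2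
    rw [ricci_eq_of_kappa g hS hκ, h22, hk, sub_self, mul_zero]
  -- the velocity is `ρ E₀ + s E₂`
  have hQpar : IsParallelAlongOn g.leviCivita γ (fun t ↦ ρ • Efr 0 t - (-s) • Efr 2 t)
      (Ioo (-2 : ℝ) 2) :=
    isParallelAlongOn_sub (isParallelAlongOn_const_smul (hEpar 0) ρ)
      (isParallelAlongOn_const_smul (hEpar 2) (-s))
  have hvelpar : IsParallelAlongOn g.leviCivita γ (fun t ↦ velocity (𝓡 3) γ t) (Ioo (-2 : ℝ) 2) :=
    (IsGeodesicOn.isParallelAlongOn_velocity hgeo).mono (subset_univ _)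
  have hvel : ∀ t ∈ Ioo (-2 : ℝ) 2, velocity (𝓡 3) γ t = ρ • Efr 0 t + s • Efr 2 t := by
    intro t ht
    have h := eq_of_isParallelAlongOn g hg' hLC.2 (ordConnected_Ioo) hvelpar hQpar h0I
      (by
        rw [hE00, hE20, neg_smul, sub_neg_eq_add]
        exact hγv) ht
    rw [h, neg_smul, sub_neg_eq_add]
  -- the curvature matrix along `γ`
  have hR : ∀ t ∈ Ioo (-2 : ℝ) 2, ∀ i k : Fin 3,
      g.val (γ t) (g.leviCivita.curvature (γ t) (Efr k t) (velocity (𝓡 3) γ t)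
        (velocity (𝓡 3) γ t)) (Efr i t) = if i = 1 ∧ k = 1 then ρ ^ 2 * (1 / 2) else 0 := by
    intro t ht i k
    change g.val (γ t) (g.riemann (γ t) (Efr k t) (velocity (𝓡 3) γ t) (velocity (𝓡 3) γ t))
      (Efr i t) = _
    rw [hvel t ht, ← hS1 (γ t)]
    exact curvature_frame_general g hg hf hsol hRic0 hS hw₀ hnull (e := fun i ↦ Efr i t)
      (hEon t ht) (hνnull t ht) ρ s i k
  -- expansion of `J` in the frame and the component equations
  have hcard : Fintype.card (Fin 3) = finrank ℝ (EuclideanSpace ℝ (Fin 3)) := by simp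
  have hexpJ : ∀ t ∈ Ioo (-2 : ℝ) 2, J t = ∑ i : Fin 3, g.val (γ t) (J t) (Efr i t) • Efr i t :=
    fun t ht ↦ eq_sum_bilin_smul_of_orthonormal (g.val (γ t)) (hEon t ht) hcard (J t)
  have hJacI : IsJacobiFieldAlongOn g γ J (Ioo (-2 : ℝ) 2) := fun t _ ↦ hJac t (mem_univ t)
  have had : ∀ i, ∀ t ∈ Ioo (-2 : ℝ) 2, HasDerivAt (fun t ↦ g.val (γ t) (J t) (Efr i t))
      (g.val (γ t) (covariantDerivAlong g.leviCivita γ J t) (Efr i t)) t := fun i t ht ↦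
    hasDerivAt_val_apply_of_isParallelAlongOn g hLC.2 (hJd t) (hEpar i) ht
  have hbd : ∀ i, ∀ t ∈ Ioo (-2 : ℝ) 2,
      HasDerivAt (fun t ↦ g.val (γ t) (covariantDerivAlong g.leviCivita γ J t) (Efr i t))
        (-(if i = 1 then ρ ^ 2 / 2 else 0) * g.val (γ t) (J t) (Efr i t)) t := by
    intro i t ht
    have h := hasDerivAt_val_covariantDerivAlong_frame_of_expansion g hJacI (hDJd t)
      (e := Efr) hEpar ht (hexpJ t ht) i
    refine h.congr_deriv ?_
    rw [Fin.sum_univ_three, hR t ht i 0, hR t ht i 1, hR t ht i 2]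
    fin_cases i <;> (simp; try ring)
  -- initial data
  have hJ0' : J 0 = 0 := hJ0
  have ha0 : ∀ i, g.val (γ 0) (J 0) (Efr i 0) = 0 := fun i ↦ by
    rw [hJ0', map_zero, _root_.zero_apply]
  have hb0 : ∀ i, g.val (γ 0) (covariantDerivAlong g.leviCivita γ J 0) (Efr i 0) =
      g.val p ξ (wfr i) := fun i ↦ by
    rw [hDJ0, hE0, hb]
  -- solving: `a₀ = ⟨ξ,u⟩ t`, `a₂ = ⟨ξ,ν⟩ t`, `a₁ = ⟨ξ,n⟩ j(t)`
  have hlin : ∀ (c : ℝ), (∀ t', HasDerivAt (fun t : ℝ ↦ c * t) c t') ∧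
      ∀ t', HasDerivAt (fun _ : ℝ ↦ c) (-(fun _ : ℝ ↦ (0 : ℝ)) t' * (c * t')) t' := fun c ↦
    ⟨fun t' ↦ ((hasDerivAt_id' t').const_mul c).congr_deriv (mul_one c),
      fun t' ↦ (hasDerivAt_const t' c).congr_deriv (by simp)⟩
  have ha0t : g.val (γ t) (J t) (Efr 0 t) = g.val p ξ u * t :=
    eq_of_hasDerivAt_two_linear_Ioo (k := fun _ ↦ (0 : ℝ)) continuousOn_const
      (had 0) (fun t ht ↦ (hbd 0 t ht).congr_deriv (by simp)) (fun t _ ↦ (hlin (g.val p ξ u)).1 t)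
      (fun t _ ↦ (hlin (g.val p ξ u)).2 t) (by rw [ha0 0, mul_zero])
      (by rw [hb0 0]; rfl) h0I ht
  have ha2t : g.val (γ t) (J t) (Efr 2 t) = g.val p ξ ν * t :=
    eq_of_hasDerivAt_two_linear_Ioo (k := fun _ ↦ (0 : ℝ)) continuousOn_const
      (had 2) (fun t ht ↦ (hbd 2 t ht).congr_deriv (by simp)) (fun t _ ↦ (hlin (g.val p ξ ν)).1 t)
      (fun t _ ↦ (hlin (g.val p ξ ν)).2 t) (by rw [ha0 2, mul_zero])
      (by rw [hb0 2]; rfl) h0I ht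
  have ha1t : g.val (γ t) (J t) (Efr 1 t) = g.val p ξ n * j t :=
    eq_of_hasDerivAt_two_linear_Ioo (k := fun _ ↦ ρ ^ 2 / 2) continuousOn_const
      (had 1) (fun t ht ↦ (hbd 1 t ht).congr_deriv (by simp))
      (w := fun t ↦ g.val p ξ n * j t) (w₁ := fun t ↦ g.val p ξ n * j₁ t)
      (fun t _ ↦ (hj t).const_mul _) (fun t _ ↦ ((hj₁ t).const_mul _).congr_deriv (by ring))
      (by rw [ha0 1, hj0, mul_zero]) (by rw [hb0 1, hj₁0, mul_one]; rfl) h0I ht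
  -- Parseval in the frame (expand the second argument only)
  have hpar : g.val (γ t) (J t) (J t) = ∑ i : Fin 3, g.val (γ t) (J t) (Efr i t) ^ 2 := by
    have h := hexpJ t ht
    calc g.val (γ t) (J t) (J t)
        = g.val (γ t) (J t) (∑ i : Fin 3, g.val (γ t) (J t) (Efr i t) • Efr i t) := by rw [← h]
      _ = ∑ i : Fin 3, g.val (γ t) (J t) (Efr i t) ^ 2 := by
          simp only [map_sum, map_smul, smul_eq_mul]
          exact Finset.sum_congr rfl fun i _ ↦ by ring
  change g.val (γ t) (J t) (J t) = _
  rw [hpar, Fin.sum_univ_three, ha0t, ha1t, ha2t]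

include hκ in
/-- **`|d(exp_p)_v ξ|²` in closed form.** With the notation of `val_jacobi_sq` and `t = 1`
(`J(1) = d(exp_p)_v(ξ)`, `JacobiVariation.velocity_geodesicVariation_eq_mfderiv_expMap`):
`|d(exp_p)_v ξ|²_g = ⟨ξ,u⟩² + j(1)² ⟨ξ,n⟩² + ⟨ξ,ν⟩²` — the pull-back `exp_p^* g` is the metric
`dr² + 2 sin²(r/√2) dθ² + dz²` of `S²(√2) × ℝ` in normal coordinates. [cite: Chavel2006, Thm. II.6.3]
[cite: MunteanuWang2016, Thm. 1.2] -/
theorem val_mfderiv_expMap_sq (hS1 : ∀ x, g.scalarCurvature x = 1)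
    (hc : IsGeodesicallyComplete g.leviCivita) {p : M} {u n ν : TangentSpace (𝓡 3) p}
    (huu : g.val p u u = 1) (hnn : g.val p n n = 1) (hνν : g.val p ν ν = 1)
    (hun : g.val p u n = 0) (huν : g.val p u ν = 0) (hnν : g.val p n ν = 0)
    (hν : g.ricci p ν ν = 0) (ρ s : ℝ) {j j₁ : ℝ → ℝ} (hj : ∀ t, HasDerivAt j (j₁ t) t)
    (hj₁ : ∀ t, HasDerivAt j₁ (-(ρ ^ 2 / 2) * j t) t) (hj0 : j 0 = 0) (hj₁0 : j₁ 0 = 1)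
    (ξ : TangentSpace (𝓡 3) p) :
    g.val (expMap g.leviCivita p (ρ • u + s • ν))
      (mfderiv 𝓘(ℝ, EuclideanSpace ℝ (Fin 3)) (𝓡 3)
        (fun w : EuclideanSpace ℝ (Fin 3) ↦ expMap g.leviCivita p (show TangentSpace (𝓡 3) p from w))
        (show EuclideanSpace ℝ (Fin 3) from ρ • u + s • ν) ξ)
      (mfderiv 𝓘(ℝ, EuclideanSpace ℝ (Fin 3)) (𝓡 3)
        (fun w : EuclideanSpace ℝ (Fin 3) ↦ expMap g.leviCivita p (show TangentSpace (𝓡 3) p from w))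
        (show EuclideanSpace ℝ (Fin 3) from ρ • u + s • ν) ξ) =
      g.val p ξ u ^ 2 + (g.val p ξ n * j 1) ^ 2 + g.val p ξ ν ^ 2 := by
  haveI := contMDiffCovariantDerivative_leviCivita_one g
  haveI := contMDiffCovariantDerivative_leviCivita_infty g le_rfl
  have h1I : (1 : ℝ) ∈ Ioo (-2 : ℝ) 2 := ⟨by norm_num, by norm_num⟩
  have h := val_jacobi_sq g hg hf hsol hRic0 hS hw₀ hnull hκ hS1 hc huu hnn hνν hun huν hnν hν ρ s
    hj hj₁ hj0 hj₁0 ξ h1I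
  rw [velocity_geodesicVariation_eq_mfderiv_expMap hc p (ρ • u + s • ν) ξ 1, one_smul, one_smul,
    ← expMap_eq_maximalGeodesic hc] at h
  simpa using h

end Along

end DegenerateShrinker

end Literature.Geometry.Riemannian

end
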